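import Summits.RiemannHypothesis.RiemannHypothesis.Theorems.WeilFormatCPolyWindowConstants
import Literature.NumberTheory.LFunctions.YoshidaWindowGramEnclosure
import Literature.Analysis.ValidatedNumerics.MultiPrecisionInterval
import HarnessLib

/-!
# Format C, design C∞ — (E) side I: kernel enclosures of the window constants `W_p(a) = ∫_{(0,2a]} ρ(t) t^p dt`

Route context: Fourier–Galerkin / Schur-complement certificates of Weil positivity on a window ("format C", design C∞;
cell memo `run/shared/lean/pub/rh-explicit/rh-explicit-weil-10/KERNEL-LEVER.md` §17–§18; supporting
stmt-RiemannHypothesis-0098; seats rh-explicit-weil-2 / weil-10).  The archimedean blocks of the polynomial-window entries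
(`WeilFormatCPolyWindowArchExpansion.lean`, `…MixedArch.lean`) are finite combinations of the window constants
`W_p(a)`, `p ≥ 1`, which `WeilFormatCPolyWindowArch.lean` writes as the node series `W_p(a) = Σ_k I_k`,
`I_k = ∫_{(0,2a]} e^{−l_k t} t^p dt = p!/l_k^{p+1} − e^{−2a l_k} P_k`, `P_k = Σ_{m≤p} p^{(m)}(2a)^{p−m}/l_k^{m+1}`,
`l_k = 2k + ½` (`setIntegral_exp_neg_mul_pow_eq`).  This file is the EVALUATION side: for a RATIONAL window `a` it
computes, in the tree's multi-precision fixed-point interval arithmetic (`NumericsMP.MI` at scale `S`), a box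
`winConstBox S Kser kred a p K H ∋ W_p(a)` from

* the near nodes `k < K` in closed form (`p!/l_k^{p+1}` and `P_k` are rational; `e^{−2a l_k} = e^{−a(4k+1)}` by `MI.exp`) —
  fixed point, so the cancellation between the two terms of `I_k` at small nodes costs integer digits, not accuracy;
* the far main part `Σ_{j≥0} p!/l_{K+j}^{p+1} = (p!/2^{p+1}) Σ_{j≥0} (j + K + ¼)^{−(p+1)}` from an INPUT box `H` of the
  Hurwitz-type value `Σ_{j≥0} (j + K + ¼)^{−(p+1)}` (certified separately, e.g. by the rational Euler–Maclaurin form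
  `Literature.Analysis.SpecialFunctions.abs_tsum_inv_pow_sub_hurwitzNatMain_le`);
* the far correction `0 ≤ Σ_{j≥0} e^{−2a l_{K+j}} P_{K+j} ≤ P_K e^{−2a l_K}/(1 − e^{−4a})` (geometric, `P_k` decreasing), put in
  as the interval `[0, that]`.

Main result **`mem_winConstBox`**: `a > 0`, `p ≥ 1`, `Σ_j (j+K+¼)^{−(p+1)}` has a sum in `H` ⟹ `W_p(a) ∈ winConstBox …`.
Pure interval plumbing over the landed analysis; standard axioms; no RH claim.
-/

set_option autoImplicit false
-- `Summit.RiemannHypothesis.RiemannHypothesis.…` is the layout-mandated namespace (summit = problem name).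
set_option linter.dupNamespace false

open Complex Filter Set MeasureTheory Finset
open scoped Real Topology

namespace Summit.RiemannHypothesis.RiemannHypothesis.Theorems.WeilFormatC

open Literature.NumberTheory.LFunctions Literature.Analysis.SpecialFunctions
open Literature.Analysis.ValidatedNumerics Literature.Analysis.ValidatedNumerics.NumericsMP

namespace WinConst

/-! ## Small interval helpers: rational points and rational multiples -/

/-- Enclosure of a rational number at scale `S`. -/
def ratBox (S : ℕ) (q : ℚ) : MI := MI.ofFrac S q.num q.den

/-- `ratBox ∋ q`. -/
theorem mem_ratBox (S : ℕ) (q : ℚ) : MI.mem S (q : ℝ) (ratBox S q) := by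
  have h := MI.mem_ofFrac S q.num (q := q.den) q.den_pos
  rw [ratBox]
  convert h using 1
  exact_mod_cast (Rat.num_div_den q).symm

/-- `x · q` for a rational `q` (exact multiplication by the numerator, outward division by the denominator). -/
def mulRatBox (I : MI) (q : ℚ) : MI := (I.mulInt q.num).divNat q.den

/-- `mulRatBox ∋ x·q`. -/
theorem mem_mulRatBox {S : ℕ} {x : ℝ} {I : MI} (hx : MI.mem S x I) (q : ℚ) :
    MI.mem S (x * q) (mulRatBox I q) := by
  have h := MI.mem_divNat (MI.mem_mulInt hx q.num) q.den_pos
  rw [mulRatBox]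
  convert h using 1
  rw [mul_div_assoc]
  congr 1
  exact_mod_cast (Rat.num_div_den q).symm

/-! ## The rational data of the node integrals -/

/-- The main term `p!/l_k^{p+1} = p!·(2/(4k+1))^{p+1}` of the `k`-th node integral. -/
def mainTerm (p k : ℕ) : ℚ := (p.factorial : ℚ) * (2 / (4 * k + 1)) ^ (p + 1)

/-- The correction polynomial `P_k = Σ_{m≤p} p^{(m)} (2a)^{p−m}/l_k^{m+1}` of the `k`-th node integral (rational for rational `a`). -/
def corrPoly (a : ℚ) (p k : ℕ) : ℚ :=
  ∑ m ∈ Finset.range (p + 1), (p.descFactorial m : ℚ) * (2 * a) ^ (p - m) * (2 / (4 * k + 1)) ^ (m + 1)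

/-- `mainTerm p k = p!/l_k^{p+1}` in `ℝ`. -/
theorem mainTerm_cast (p k : ℕ) : (mainTerm p k : ℝ) = (p.factorial : ℝ) / digammaNode k ^ (p + 1) := by
  rw [mainTerm, digammaNode]
  push_cast
  have hk : (4 * (k : ℝ) + 1) ≠ 0 := by positivity
  have hl : (2 * (k : ℝ) + 1 / 2) = (4 * k + 1) / 2 := by ring
  rw [hl, div_pow, div_pow, div_div_eq_mul_div]
  ring

/-- `corrPoly a p k = Σ_{m≤p} p^{(m)} (2a)^{p−m}/l_k^{m+1}` in `ℝ`. -/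
theorem corrPoly_cast (a : ℚ) (p k : ℕ) : (corrPoly a p k : ℝ) =
    ∑ m ∈ Finset.range (p + 1), (p.descFactorial m : ℝ) * (2 * (a : ℝ)) ^ (p - m) / digammaNode k ^ (m + 1) := by
  rw [corrPoly, digammaNode]
  push_cast
  refine Finset.sum_congr rfl fun m _ ↦ ?_
  have hl : (2 * (k : ℝ) + 1 / 2) = (4 * k + 1) / 2 := by ring
  rw [hl, div_pow, div_pow, div_div_eq_mul_div]
  ring

/-- The correction polynomial is non-negative (`a ≥ 0`). -/
theorem corrPoly_cast_nonneg {a : ℚ} (ha : 0 ≤ a) (p k : ℕ) : 0 ≤ (corrPoly a p k : ℝ) := by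
  rw [corrPoly_cast]
  have ha' : (0 : ℝ) ≤ a := by exact_mod_cast ha
  exact Finset.sum_nonneg fun m _ ↦
    div_nonneg (mul_nonneg (Nat.cast_nonneg _) (pow_nonneg (mul_nonneg zero_le_two ha') _))
      (pow_nonneg (digammaNode_pos k).le _)

/-- The correction polynomial decreases along the nodes: `P_{k'} ≤ P_k` for `k ≤ k'` (`a ≥ 0`). -/
theorem corrPoly_cast_antitone {a : ℚ} (ha : 0 ≤ a) (p : ℕ) {k k' : ℕ} (hkk : k ≤ k') :
    (corrPoly a p k' : ℝ) ≤ (corrPoly a p k : ℝ) := by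
  rw [corrPoly_cast, corrPoly_cast]
  have ha' : (0 : ℝ) ≤ a := by exact_mod_cast ha
  refine Finset.sum_le_sum fun m _ ↦ ?_
  have hl := digammaNode_pos k
  have hll : digammaNode k ≤ digammaNode k' := by
    unfold digammaNode
    have : (k : ℝ) ≤ k' := by exact_mod_cast hkk
    linarith
  exact div_le_div_of_nonneg_left (mul_nonneg (Nat.cast_nonneg _) (pow_nonneg (mul_nonneg zero_le_two ha') _))
    (pow_pos hl _) (pow_le_pow_left₀ hl.le hll _)

/-! ## The boxes -/

/-- `e^{−2a l_k} = e^{−a(4k+1)}` by the interval exponential. -/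
def nodeExp (S Kser kred : ℕ) (a : ℚ) (k : ℕ) : Option MI :=
  MI.exp S Kser kred (ratBox S (-(a * (4 * k + 1))))

/-- `nodeExp ∋ e^{−2a l_k}`. -/
theorem mem_nodeExp {S : ℕ} (hS : 0 < S) {Kser kred : ℕ} {a : ℚ} {k : ℕ} {E : MI}
    (h : nodeExp S Kser kred a k = some E) : MI.mem S (Real.exp (-(2 * (a : ℝ) * digammaNode k))) E := by
  have hm := MI.mem_exp hS h (mem_ratBox S (-(a * (4 * k + 1))))
  convert hm using 2
  rw [digammaNode]
  push_cast
  ring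

/-- The sum of the near node integrals `Σ_{k<K} I_k`, `I_k = p!/l_k^{p+1} − e^{−2a l_k} P_k`. -/
def nearSum (S Kser kred : ℕ) (a : ℚ) (p : ℕ) : ℕ → Option MI
  | 0 => some (MI.ofInt S 0)
  | K + 1 =>
    match nearSum S Kser kred a p K, nodeExp S Kser kred a K with
    | some acc, some E => some (acc.add ((ratBox S (mainTerm p K)).sub (mulRatBox E (corrPoly a p K))))
    | _, _ => none

/-- The scaled upper end of `P_K e^{−2a l_K}/(1 − e^{−4a})`, the majorant of the far correction. -/
def farCorrHi (S Kser kred : ℕ) (a : ℚ) (p K : ℕ) : Option ℤ :=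
  match nodeExp S Kser kred a K, MI.exp S Kser kred (ratBox S (-(4 * a))) with
  | some E, some E4 =>
    match MI.divPos S (mulRatBox E (corrPoly a p K)) ((MI.ofInt S 1).sub E4) with
    | some Q => some Q.hi
    | none => none
  | _, _ => none

/-- **The window-constant box**: `Σ_{k<K} I_k + (p!/2^{p+1})·H − [0, P_K e^{−2a l_K}/(1−e^{−4a})]`, where `H` is an input
box for the Hurwitz-type value `Σ_{j≥0} (j + K + ¼)^{−(p+1)}`. -/
def winConstBox (S Kser kred : ℕ) (a : ℚ) (p K : ℕ) (H : MI) : Option MI :=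
  match nearSum S Kser kred a p K, farCorrHi S Kser kred a p K with
  | some N, some u => some ((N.add (mulRatBox H ((p.factorial : ℚ) / 2 ^ (p + 1)))).sub ⟨0, u⟩)
  | _, _ => none

/-! ## Soundness -/

section Soundness

variable {S Kser kred : ℕ} {a : ℚ} {p : ℕ}

/-- The `k`-th node integral `I_k = ∫_{(0,2a]} e^{−l_k t} t^p dt`. -/
private noncomputable def nodeInt (a : ℚ) (p k : ℕ) : ℝ :=
  ∫ t in Ioc 0 (2 * (a : ℝ)), Real.exp (-(digammaNode k * t)) * t ^ p

/-- `I_k = p!/l_k^{p+1} − e^{−2a l_k} P_k` with the rational data. -/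
private theorem nodeInt_eq (ha : 0 ≤ a) (p k : ℕ) :
    nodeInt a p k = (mainTerm p k : ℝ) - Real.exp (-(2 * (a : ℝ) * digammaNode k)) * (corrPoly a p k : ℝ) := by
  have ha' : (0 : ℝ) ≤ a := by exact_mod_cast ha
  have hT : (0 : ℝ) ≤ 2 * (a : ℝ) := mul_nonneg zero_le_two ha'
  rw [nodeInt, setIntegral_exp_neg_mul_pow_eq (digammaNode_pos k).ne' hT p, mainTerm_cast, corrPoly_cast,
    Finset.mul_sum, Finset.mul_sum, show digammaNode k * (2 * (a : ℝ)) = 2 * (a : ℝ) * digammaNode k by ring]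

/-- **Soundness of `nearSum`**: it encloses `Σ_{k<K} I_k`. -/
theorem mem_nearSum (hS : 0 < S) (ha : 0 ≤ a) :
    ∀ (K : ℕ) {N : MI}, nearSum S Kser kred a p K = some N →
      MI.mem S (∑ k ∈ Finset.range K, ∫ t in Ioc 0 (2 * (a : ℝ)), Real.exp (-(digammaNode k * t)) * t ^ p) N
  | 0, N, h => by
    simp only [nearSum, Option.some.injEq] at h
    subst h
    simpa using MI.mem_ofInt S 0
  | K + 1, N, h => by
    simp only [nearSum] at h
    split at h
    · rename_i acc E hacc hE
      simp only [Option.some.injEq] at h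
      subst h
      rw [Finset.sum_range_succ]
      refine MI.mem_add (mem_nearSum hS ha K hacc) ?_
      have hI := nodeInt_eq ha p K
      rw [nodeInt] at hI
      rw [hI]
      exact MI.mem_sub (mem_ratBox S _) (mem_mulRatBox (mem_nodeExp hS hE) _)
    · simp at h

/-- `e^{−2a l_{K+j}} = e^{−2a l_K} · (e^{−4a})^j`. -/
private theorem exp_node_shift (a : ℝ) (K j : ℕ) :
    Real.exp (-(2 * a * digammaNode (K + j))) = Real.exp (-(2 * a * digammaNode K)) * Real.exp (-(4 * a)) ^ j := by
  rw [← Real.exp_nat_mul, ← Real.exp_add]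
  congr 1
  unfold digammaNode
  push_cast
  ring

/-- **Soundness of `farCorrHi`**: `0 ≤ Σ_j e^{−2a l_{K+j}} P_{K+j} ≤ u/S` whenever the far correction series has sum `F`. -/
theorem farCorr_mem (hS : 0 < S) (ha : 0 < a) {K : ℕ} {u : ℤ} (hu : farCorrHi S Kser kred a p K = some u) {F : ℝ}
    (hF : HasSum (fun j : ℕ ↦ Real.exp (-(2 * (a : ℝ) * digammaNode (K + j))) * (corrPoly a p (K + j) : ℝ)) F) :
    MI.mem S F ⟨0, u⟩ := by
  have ha' : (0 : ℝ) < a := by exact_mod_cast ha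
  have hSr : (0 : ℝ) < S := by exact_mod_cast hS
  -- non-negativity
  have hF0 : 0 ≤ F :=
    hF.nonneg fun j ↦ mul_nonneg (Real.exp_pos _).le (corrPoly_cast_nonneg ha.le p (K + j))
  -- the geometric majorant
  set r : ℝ := Real.exp (-(4 * (a : ℝ))) with hr
  have hr0 : 0 ≤ r := (Real.exp_pos _).le
  have hr1 : r < 1 := by rw [hr]; exact Real.exp_lt_one_iff.2 (by linarith)
  set eK : ℝ := Real.exp (-(2 * (a : ℝ) * digammaNode K)) with heK
  set PK : ℝ := (corrPoly a p K : ℝ) with hPK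
  have hPK0 : 0 ≤ PK := corrPoly_cast_nonneg ha.le p K
  have hgeom : HasSum (fun j : ℕ ↦ eK * PK * r ^ j) (eK * PK * (1 - r)⁻¹) :=
    (hasSum_geometric_of_lt_one hr0 hr1).mul_left (eK * PK)
  have hle : F ≤ eK * PK * (1 - r)⁻¹ := by
    refine hasSum_le (fun j ↦ ?_) hF hgeom
    rw [exp_node_shift, ← heK]
    have h1 : (corrPoly a p (K + j) : ℝ) ≤ PK := corrPoly_cast_antitone ha.le p (Nat.le_add_right K j)
    have h2 : 0 ≤ eK * r ^ j := by positivity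
    nlinarith
  -- the box
  unfold farCorrHi at hu
  split at hu
  · rename_i E E4 hE hE4
    split at hu
    · rename_i Q hQ
      simp only [Option.some.injEq] at hu
      subst hu
      have hEm := mem_nodeExp hS hE
      have hE4m : MI.mem S r E4 := by
        have := MI.mem_exp hS hE4 (mem_ratBox S (-(4 * a)))
        rw [hr]; convert this using 2; push_cast; ring
      have hden : MI.mem S (1 - r) ((MI.ofInt S 1).sub E4) := by
        have := MI.mem_sub (MI.mem_ofInt S 1) hE4m
        simpa using this
      have hnum : MI.mem S (eK * PK) (mulRatBox E (corrPoly a p K)) := mem_mulRatBox hEm _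
      have hQm := MI.mem_divPos hS hQ hnum hden
      rw [div_eq_mul_inv] at hQm
      refine ⟨?_, ?_⟩
      · push_cast; positivity
      · exact le_trans (mul_le_mul_of_nonneg_right hle hSr.le) hQm.2
    · simp at hu
  · simp at hu

/-- **Soundness of the window-constant box.**  For a rational window `a > 0`, `p ≥ 1`, a cut `K` and a box `H` containing
the sum of `Σ_{j≥0} (j + K + ¼)^{−(p+1)}`:  `W_p(a) = ∫_{(0,2a]} ρ(t) t^p dt ∈ winConstBox S Kser kred a p K H`. -/
theorem mem_winConstBox (hS : 0 < S) (ha : 0 < a) (hp : 1 ≤ p) {K : ℕ} {H W : MI}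
    (hH : ∃ h : ℝ, HasSum (fun j : ℕ ↦ ((((j : ℝ) + (K + 1 / 4)) ^ (p + 1))⁻¹)) h ∧ MI.mem S h H)
    (hW : winConstBox S Kser kred a p K H = some W) :
    MI.mem S (∫ t in Ioc 0 (2 * (a : ℝ)), weilArchDensity t * t ^ p) W := by
  have ha' : (0 : ℝ) < a := by exact_mod_cast ha
  obtain ⟨q, rfl⟩ : ∃ q, p = q + 1 := ⟨p - 1, by omega⟩
  obtain ⟨h, hh, hHm⟩ := hH
  -- the node series and its split at `K`
  have hnodes := hasSum_setIntegral_weilArchDensity_mul_pow_succ ha' q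
  have hsplit := (hnodes.summable.sum_add_tsum_nat_add K).symm
  rw [hnodes.tsum_eq] at hsplit
  have hfar : HasSum (fun j : ℕ ↦ nodeInt a (q + 1) (j + K)) (∑' j : ℕ, nodeInt a (q + 1) (j + K)) :=
    ((summable_nat_add_iff K).2 hnodes.summable).hasSum
  -- far main part: `p!/l_{K+j}^{p+1} = (p!/2^{p+1}) (j + K + ¼)^{-(p+1)}`
  have hmainj : ∀ j : ℕ, (mainTerm (q + 1) (j + K) : ℝ) =
      ((((j : ℝ) + (K + 1 / 4)) ^ (q + 1 + 1))⁻¹) * ((((q + 1).factorial : ℚ) / 2 ^ (q + 1 + 1) : ℚ) : ℝ) := by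
    intro j
    rw [mainTerm_cast, digammaNode]
    push_cast
    have hx : ((j : ℝ) + (K + 1 / 4)) ≠ 0 := by positivity
    have e : (2 * ((j : ℝ) + (K : ℝ)) + 1 / 2) = 2 * ((j : ℝ) + (K + 1 / 4)) := by ring
    rw [e, mul_pow]
    field_simp
  have hmain : HasSum (fun j : ℕ ↦ (mainTerm (q + 1) (j + K) : ℝ))
      (h * ((((q + 1).factorial : ℚ) / 2 ^ (q + 1 + 1) : ℚ) : ℝ)) := by
    simp_rw [hmainj]
    exact hh.mul_right _
  -- far correction
  have hcorr : HasSum (fun j : ℕ ↦ Real.exp (-(2 * (a : ℝ) * digammaNode (K + j))) * (corrPoly a (q + 1) (K + j) : ℝ))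
      (h * ((((q + 1).factorial : ℚ) / 2 ^ (q + 1 + 1) : ℚ) : ℝ) - ∑' j : ℕ, nodeInt a (q + 1) (j + K)) := by
    have := hmain.sub hfar
    refine this.congr_fun fun j ↦ ?_
    rw [nodeInt_eq ha.le, add_comm j K]
    ring
  -- unpack the box
  unfold winConstBox at hW
  split at hW
  · rename_i N u hN hu
    simp only [Option.some.injEq] at hW
    subst hW
    have hNm := mem_nearSum hS ha.le K hN
    have hFC := farCorr_mem hS ha hu hcorr
    have hHm' := mem_mulRatBox hHm (((q + 1).factorial : ℚ) / 2 ^ (q + 1 + 1))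
    have htot := MI.mem_sub (MI.mem_add hNm hHm') hFC
    convert htot using 1
    rw [hsplit]
    have e : ∑' j : ℕ, nodeInt a (q + 1) (j + K) =
        ∑' k : ℕ, ∫ t in Ioc 0 (2 * (a : ℝ)), Real.exp (-(digammaNode (k + K) * t)) * t ^ (q + 1) := rfl
    rw [← e]
    ring
  · simp at hW

end Soundness

end WinConst

end Summit.RiemannHypothesis.RiemannHypothesis.Theorems.WeilFormatC
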